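import Literature.NumberTheory.Transcendental.KZIntervalPeriodProofs
import Literature.NumberTheory.Transcendental.SemialgebraicLineDeriv
import Literature.NumberTheory.Transcendental.KZCubicalCalculus
import Summits.KontsevichZagierPeriods.KontsevichZagierPeriods.Theorems.UnfoldedStokesStokesGenerationStubRungAngularCertificate

/-!
# `StokesGeneration` (stmt-KontsevichZagierPeriods-3586) — line `fibrewise_stokes`, stub `stub_rungAngularCertificateSwap`

Registered rung stub R9′ of the line `fibrewise_stokes` of the crux `StokesGeneration`
(route UnfoldedStokes): **the two-element divergence certificate for the angular derivative of a
closed loop with positive real part, in SWAPPED coordinates** on the closed square `[0,1]²` — the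
loop variable is `y = x 1` and the auxiliary variable is `z = x 0` (rung 4 of the line produces a
boundary leftover living in the second coordinate of the square, and rung 3's certificate
`stub_rungAngularCertificate` (R9) is needed with the roles of the two coordinates exchanged).

Let `P = A + iB` be a loop parametrised by `[0,1]`: `A > 0` on `[0,1]`, `B 0 = B 1 = 0`, `A`, `B`
continuous on `[0,1]` together with `A'`, `B'`, differentiable on `(0,1)` with these derivatives,
all four `ℚ`-semialgebraic as functions of `x 1` on the square, and let `γ` be real algebraic.
With `K = A B' − A' B`, `E₁ = A² + B²` and `E = A² + B² z² ≥ A² > 0` on the square, the two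
primitives `G₀ = γ A B/E` (element `0`, direction `Fin.rev 0 = 1`) and
`G₁ = γ z K (1/E₁ − 1/E)` (element `1`, direction `Fin.rev 1 = 0`) have fibre derivatives
`D₀ = γ K (A² − B² z²)/E²`, `D₁ = γ K (1/E₁ − (A² − B² z²)/E²)` with `D₀ + D₁ = γ K/E₁`, and ALL
four boundary values `G₀|_{y=1}`, `G₀|_{y=0}`, `G₁|_{z=1}`, `G₁|_{z=0}` vanish identically
(`B 0 = B 1 = 0`, the factor `z`, and `E|_{z=1} = E₁`). Hence `γ K/E₁` is the sum of the two
fibrewise Stokes elements `Dⱼ − (Gⱼ|_{x_{rev j}=1} − Gⱼ|_{x_{rev j}=0}) = Dⱼ`, carried by the closed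
square with the continuous (hence integrable) `ℚ`-semialgebraic integrands `Dⱼ`; `Gⱼ` is bounded
on the compact square by continuity, and there is no kink set. Semialgebraicity is closure of
`ℚ`-semialgebraic functions under field operations (Bochnak–Coste–Roy, Prop. 2.2.6) applied to the
atoms `A (x 1)`, `B (x 1)`, `A' (x 1)`, `B' (x 1)`, `x 0`, `γ`, `1`. The one-variable calculus
along the fibres is R9's (`rungAng_hasDerivAt_dir0`, `rungAng_hasDerivAt_dir1`), reused verbatim.

References: J. Ayoub, *Une version relative de la conjecture des périodes de Kontsevich–Zagier*,
Ann. of Math. 181 (2015), Rem. 1.5; M. Kontsevich, D. Zagier, *Periods* (2001), §1.2;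
J. Bochnak, M. Coste, M.-F. Roy, *Real Algebraic Geometry* (1998), Prop. 2.2.6.
-/

noncomputable section

-- `Summit.KontsevichZagierPeriods.KontsevichZagierPeriods.…` is the tree's mandated layout (single-conjunct summit).
set_option linter.dupNamespace false

namespace Summit.KontsevichZagierPeriods.KontsevichZagierPeriods.Cruxes.StokesGeneration.FibrewiseStokes

open MeasureTheory Set
open Literature.NumberTheory.Transcendental
open Literature.NumberTheory.Transcendental.KZ
open Literature.ModelTheory.ExponentialFields (IsSemialgebraic)

/-! ## The two directions of the square, reversed -/

/-- In `Fin 2`, the reverse of `0` is `1`. [folklore] -/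
theorem rungAngSwap_rev_zero : Fin.rev (0 : Fin 2) = 1 := by decide

/-- In `Fin 2`, the reverse of `1` is `0`. [folklore] -/
theorem rungAngSwap_rev_one : Fin.rev (1 : Fin 2) = 0 := by decide

/-! ## The certificate -/

/-- **Registered stub `stub_rungAngularCertificateSwap` (R9′): the two-element divergence
certificate for the angular derivative of a closed loop with positive real part, in swapped
coordinates.** If `A > 0` on `[0,1]`, `B 0 = B 1 = 0`, `A`, `B` are differentiable on `(0,1)`
with derivatives `A'`, `B'`, all four continuous on `[0,1]` and `ℚ`-semialgebraic (as functions
of `x 1` on the square), and `γ` is real algebraic, then `γ · (A B' − A' B)/(A² + B²)` (a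
function of `x 1` on `[0,1]²`) is the sum of two fibrewise Stokes elements: element `0` in
direction `Fin.rev 0 = 1` with primitive `G₀ = γ A B/(A² + B² x₀²)`, element `1` in direction
`Fin.rev 1 = 0` with primitive `G₁ = γ x₀ (A B' − A' B) (1/(A² + B²) − 1/(A² + B² x₀²))`, no
kink set; all four boundary terms vanish and `∂₁ G₀ + ∂₀ G₁ = γ (A B' − A' B)/(A² + B²)`.
[cite: Ayoub2015, Rem. 1.5] -/
theorem stub_rungAngularCertificateSwap :
    ∀ (γ : ℝ) (A B A' B' : ℝ → ℝ), IsAlgebraic ℚ γ →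
      IsSemialgebraicFunOn ℚ (Set.pi Set.univ (fun _ : Fin 2 => Set.Icc (0:ℝ) 1)) (fun x => A (x 1)) →
      IsSemialgebraicFunOn ℚ (Set.pi Set.univ (fun _ : Fin 2 => Set.Icc (0:ℝ) 1)) (fun x => B (x 1)) →
      IsSemialgebraicFunOn ℚ (Set.pi Set.univ (fun _ : Fin 2 => Set.Icc (0:ℝ) 1)) (fun x => A' (x 1)) →
      IsSemialgebraicFunOn ℚ (Set.pi Set.univ (fun _ : Fin 2 => Set.Icc (0:ℝ) 1)) (fun x => B' (x 1)) →
      (∀ u ∈ Set.Icc (0:ℝ) 1, 0 < A u) → B 0 = 0 → B 1 = 0 →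
      ContinuousOn A (Set.Icc (0:ℝ) 1) → ContinuousOn B (Set.Icc (0:ℝ) 1) →
      ContinuousOn A' (Set.Icc (0:ℝ) 1) → ContinuousOn B' (Set.Icc (0:ℝ) 1) →
      (∀ u ∈ Set.Ioo (0:ℝ) 1, HasDerivAt A (A' u) u) → (∀ u ∈ Set.Ioo (0:ℝ) 1, HasDerivAt B (B' u) u) →
      ∃ (G D : Fin 2 → (Fin 2 → ℝ) → ℝ) (q : Fin 2 → IntegralRep 2),
        (∀ j, IsSemialgebraicFunOn ℚ (Set.pi Set.univ (fun _ : Fin 2 => Set.Icc (0:ℝ) 1)) (G j) ∧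
          IsSemialgebraicFunOn ℚ (Set.pi Set.univ (fun _ : Fin 2 => Set.Icc (0:ℝ) 1)) (D j) ∧
          (∃ B : ℝ, ∀ x ∈ Set.pi Set.univ (fun _ : Fin 2 => Set.Icc (0:ℝ) 1), |(G j) x| ≤ B) ∧
          (∀ x ∈ Set.pi Set.univ (fun _ : Fin 2 => Set.Icc (0:ℝ) 1),
            ContinuousOn (fun s : ℝ => (G j) (Function.update x (Fin.rev j) s)) (Set.Icc (0:ℝ) 1)) ∧
          (∀ x ∈ Set.pi Set.univ (fun _ : Fin 2 => Set.Icc (0:ℝ) 1), x (Fin.rev j) ∈ Set.Ioo (0:ℝ) 1 →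
            HasDerivAt (fun s : ℝ => (G j) (Function.update x (Fin.rev j) s)) ((D j) x) (x (Fin.rev j)))) ∧
        (∀ j, (q j).domain = Set.pi Set.univ (fun _ : Fin 2 => Set.Icc (0:ℝ) 1) ∧
          ∀ x ∈ Set.pi Set.univ (fun _ : Fin 2 => Set.Icc (0:ℝ) 1), (q j).integrand x =
            D j x - (G j (Function.update x (Fin.rev j) 1) - G j (Function.update x (Fin.rev j) 0))) ∧
        ∀ x ∈ Set.pi Set.univ (fun _ : Fin 2 => Set.Icc (0:ℝ) 1),
          γ * ((A (x 1) * B' (x 1) - A' (x 1) * B (x 1)) / (A (x 1) ^ 2 + B (x 1) ^ 2)) =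
            ∑ j, (q j).integrand x := by
  intro γ A B A' B' hγ hA hB hA' hB' hpos hB0 hB1 hAc hBc hA'c hB'c hderA hderB
  -- the closed square and what holds on it
  set S : Set (Fin 2 → ℝ) := Set.pi Set.univ (fun _ : Fin 2 => Set.Icc (0:ℝ) 1) with hS
  have hSsa : IsSemialgebraic ℚ S := by rw [hS, ← cube_eq_pi]; exact isSemialgebraic_cube
  have hSc : IsCompact S := isCompact_univ_pi fun _ => isCompact_Icc
  have h10 : (1 : Fin 2) ≠ 0 := by decide
  have h01 : (0 : Fin 2) ≠ 1 := by decide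
  have hmem : ∀ x ∈ S, ∀ i, x i ∈ Set.Icc (0:ℝ) 1 := fun x hx i => (Set.mem_univ_pi.mp hx) i
  have hApos : ∀ x ∈ S, 0 < A (x 1) := fun x hx => hpos _ (hmem x hx 1)
  -- the two denominators `E₁ = A² + B²` and `E = A² + B² z²` are positive on the square
  have hE1pos : ∀ x ∈ S, 0 < A (x 1) ^ 2 + B (x 1) ^ 2 := fun x hx =>
    add_pos_of_pos_of_nonneg (pow_pos (hApos x hx) 2) (sq_nonneg _)
  have hEpos : ∀ x ∈ S, 0 < A (x 1) ^ 2 + B (x 1) ^ 2 * x 0 ^ 2 := fun x hx =>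
    add_pos_of_pos_of_nonneg (pow_pos (hApos x hx) 2) (mul_nonneg (sq_nonneg _) (sq_nonneg _))
  have hE1ne : ∀ x ∈ S, A (x 1) ^ 2 + B (x 1) ^ 2 ≠ 0 := fun x hx => (hE1pos x hx).ne'
  have hEne : ∀ x ∈ S, A (x 1) ^ 2 + B (x 1) ^ 2 * x 0 ^ 2 ≠ 0 := fun x hx => (hEpos x hx).ne'
  have hE2ne : ∀ x ∈ S, (A (x 1) ^ 2 + B (x 1) ^ 2 * x 0 ^ 2) ^ 2 ≠ 0 := fun x hx =>
    pow_ne_zero 2 (hEne x hx)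
  -- moving one coordinate inside `[0,1]` stays in the square
  have hupd : ∀ x ∈ S, ∀ (j : Fin 2), ∀ s ∈ Set.Icc (0:ℝ) 1, Function.update x j s ∈ S := by
    intro x hx j s hs
    refine Set.mem_univ_pi.mpr fun i => ?_
    rcases eq_or_ne i j with rfl | hij
    · simpa using hs
    · rw [Function.update_of_ne hij]
      exact hmem x hx i
  -- semialgebraic atoms and building blocks on the square (BCR Prop. 2.2.6)
  have hx0sa : IsSemialgebraicFunOn ℚ S (fun x => x 0) := isSemialgebraicFunOn_apply hSsa 0
  have hγsa : IsSemialgebraicFunOn ℚ S (fun _ => γ) :=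
    isSemialgebraicFunOn_const_of_isAlgebraic hSsa hγ
  have h1sa : IsSemialgebraicFunOn ℚ S (fun _ => (1:ℝ)) :=
    isSemialgebraicFunOn_const_of_isAlgebraic hSsa isAlgebraic_one
  have hKsa : IsSemialgebraicFunOn ℚ S (fun x => A (x 1) * B' (x 1) - A' (x 1) * B (x 1)) :=
    (hA.fun_mul hB').fun_sub (hA'.fun_mul hB)
  have hE1sa : IsSemialgebraicFunOn ℚ S (fun x => A (x 1) ^ 2 + B (x 1) ^ 2) :=
    (hA.fun_pow 2).fun_add (hB.fun_pow 2)
  have hEsa : IsSemialgebraicFunOn ℚ S (fun x => A (x 1) ^ 2 + B (x 1) ^ 2 * x 0 ^ 2) :=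
    (hA.fun_pow 2).fun_add ((hB.fun_pow 2).fun_mul (hx0sa.fun_pow 2))
  have hNsa : IsSemialgebraicFunOn ℚ S (fun x => A (x 1) ^ 2 - B (x 1) ^ 2 * x 0 ^ 2) :=
    (hA.fun_pow 2).fun_sub ((hB.fun_pow 2).fun_mul (hx0sa.fun_pow 2))
  -- continuity atoms and building blocks on the square
  have hAS : ContinuousOn (fun x : Fin 2 → ℝ => A (x 1)) S :=
    hAc.comp (continuous_apply 1).continuousOn fun x hx => hmem x hx 1
  have hBS : ContinuousOn (fun x : Fin 2 → ℝ => B (x 1)) S :=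
    hBc.comp (continuous_apply 1).continuousOn fun x hx => hmem x hx 1
  have hA'S : ContinuousOn (fun x : Fin 2 → ℝ => A' (x 1)) S :=
    hA'c.comp (continuous_apply 1).continuousOn fun x hx => hmem x hx 1
  have hB'S : ContinuousOn (fun x : Fin 2 → ℝ => B' (x 1)) S :=
    hB'c.comp (continuous_apply 1).continuousOn fun x hx => hmem x hx 1
  have hx0S : ContinuousOn (fun x : Fin 2 → ℝ => x 0) S := (continuous_apply 0).continuousOn
  have hKS : ContinuousOn (fun x : Fin 2 → ℝ => A (x 1) * B' (x 1) - A' (x 1) * B (x 1)) S :=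
    (hAS.fun_mul hB'S).fun_sub (hA'S.fun_mul hBS)
  have hE1S : ContinuousOn (fun x : Fin 2 → ℝ => A (x 1) ^ 2 + B (x 1) ^ 2) S :=
    (hAS.pow 2).fun_add (hBS.pow 2)
  have hES : ContinuousOn (fun x : Fin 2 → ℝ => A (x 1) ^ 2 + B (x 1) ^ 2 * x 0 ^ 2) S :=
    (hAS.pow 2).fun_add ((hBS.pow 2).fun_mul (hx0S.pow 2))
  have hE2S : ContinuousOn (fun x : Fin 2 → ℝ => (A (x 1) ^ 2 + B (x 1) ^ 2 * x 0 ^ 2) ^ 2) S :=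
    hES.pow 2
  have hNS : ContinuousOn (fun x : Fin 2 → ℝ => A (x 1) ^ 2 - B (x 1) ^ 2 * x 0 ^ 2) S :=
    (hAS.pow 2).fun_sub ((hBS.pow 2).fun_mul (hx0S.pow 2))
  -- the witnesses
  set G0 : (Fin 2 → ℝ) → ℝ := fun x =>
    γ * (A (x 1) * B (x 1)) / (A (x 1) ^ 2 + B (x 1) ^ 2 * x 0 ^ 2) with hG0
  set D0 : (Fin 2 → ℝ) → ℝ := fun x =>
    γ * ((A (x 1) * B' (x 1) - A' (x 1) * B (x 1)) * (A (x 1) ^ 2 - B (x 1) ^ 2 * x 0 ^ 2)) /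
      (A (x 1) ^ 2 + B (x 1) ^ 2 * x 0 ^ 2) ^ 2 with hD0
  set G1 : (Fin 2 → ℝ) → ℝ := fun x =>
    γ * x 0 * (A (x 1) * B' (x 1) - A' (x 1) * B (x 1)) *
      (1 / (A (x 1) ^ 2 + B (x 1) ^ 2) - 1 / (A (x 1) ^ 2 + B (x 1) ^ 2 * x 0 ^ 2)) with hG1
  set D1 : (Fin 2 → ℝ) → ℝ := fun x =>
    γ * (A (x 1) * B' (x 1) - A' (x 1) * B (x 1)) *
      (1 / (A (x 1) ^ 2 + B (x 1) ^ 2) -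
        (A (x 1) ^ 2 - B (x 1) ^ 2 * x 0 ^ 2) / (A (x 1) ^ 2 + B (x 1) ^ 2 * x 0 ^ 2) ^ 2) with hD1
  -- semialgebraicity (closure under field operations, BCR Prop. 2.2.6)
  have hG0sa : IsSemialgebraicFunOn ℚ S G0 := (hγsa.fun_mul (hA.fun_mul hB)).div hEsa hEne
  have hD0sa : IsSemialgebraicFunOn ℚ S D0 :=
    (hγsa.fun_mul (hKsa.fun_mul hNsa)).div (hEsa.fun_pow 2) hE2ne
  have hG1sa : IsSemialgebraicFunOn ℚ S G1 :=
    ((hγsa.fun_mul hx0sa).fun_mul hKsa).fun_mul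
      ((h1sa.div hE1sa hE1ne).fun_sub (h1sa.div hEsa hEne))
  have hD1sa : IsSemialgebraicFunOn ℚ S D1 :=
    (hγsa.fun_mul hKsa).fun_mul
      ((h1sa.div hE1sa hE1ne).fun_sub (hNsa.div (hEsa.fun_pow 2) hE2ne))
  -- continuity on the square
  have hG0c : ContinuousOn G0 S := (continuousOn_const.fun_mul (hAS.fun_mul hBS)).div₀ hES hEne
  have hD0c : ContinuousOn D0 S :=
    (continuousOn_const.fun_mul (hKS.fun_mul hNS)).div₀ hE2S hE2ne
  have hG1c : ContinuousOn G1 S :=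
    ((continuousOn_const.fun_mul hx0S).fun_mul hKS).fun_mul
      ((continuousOn_const.div₀ hE1S hE1ne).fun_sub (continuousOn_const.div₀ hES hEne))
  have hD1c : ContinuousOn D1 S :=
    (continuousOn_const.fun_mul hKS).fun_mul
      ((continuousOn_const.div₀ hE1S hE1ne).fun_sub (hNS.div₀ hE2S hE2ne))
  -- packaged as `Fin 2`-families
  set G : Fin 2 → (Fin 2 → ℝ) → ℝ := ![G0, G1] with hG
  set D : Fin 2 → (Fin 2 → ℝ) → ℝ := ![D0, D1] with hD
  have hGsa : ∀ j, IsSemialgebraicFunOn ℚ S (G j) := Fin.forall_fin_two.2 ⟨hG0sa, hG1sa⟩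
  have hDsa : ∀ j, IsSemialgebraicFunOn ℚ S (D j) := Fin.forall_fin_two.2 ⟨hD0sa, hD1sa⟩
  have hGc : ∀ j, ContinuousOn (G j) S := Fin.forall_fin_two.2 ⟨hG0c, hG1c⟩
  have hDc : ∀ j, ContinuousOn (D j) S := Fin.forall_fin_two.2 ⟨hD0c, hD1c⟩
  -- all four boundary values vanish identically
  have hG_one : ∀ j x, G j (Function.update x (Fin.rev j) 1) = 0 := by
    refine Fin.forall_fin_two.2 ⟨fun x => ?_, fun x => ?_⟩
    · simp only [rungAngSwap_rev_zero, hG, hG0, Matrix.cons_val_zero, Function.update_self, hB1]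
      ring
    · simp only [rungAngSwap_rev_one, hG, hG1, Matrix.cons_val_one, Matrix.cons_val_fin_one,
        Function.update_self, Function.update_of_ne h10]
      ring
  have hG_zero : ∀ j x, G j (Function.update x (Fin.rev j) 0) = 0 := by
    refine Fin.forall_fin_two.2 ⟨fun x => ?_, fun x => ?_⟩
    · simp only [rungAngSwap_rev_zero, hG, hG0, Matrix.cons_val_zero, Function.update_self, hB0]
      ring
    · simp only [rungAngSwap_rev_one, hG, hG1, Matrix.cons_val_one, Matrix.cons_val_fin_one,
        Function.update_self]
      ring
  -- bounds on the compact square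
  have hGbd : ∀ j, ∃ B : ℝ, ∀ x ∈ S, |G j x| ≤ B := fun j => by
    obtain ⟨B, hB⟩ := hSc.exists_bound_of_continuousOn (hGc j)
    exact ⟨B, fun x hx => by simpa only [Real.norm_eq_abs] using hB x hx⟩
  -- continuity along closed fibres
  have hGfib : ∀ j, ∀ x ∈ S,
      ContinuousOn (fun s : ℝ => G j (Function.update x (Fin.rev j) s)) (Set.Icc (0:ℝ) 1) := by
    intro j x hx
    have hc : Continuous fun s : ℝ => Function.update x (Fin.rev j) s :=
      continuous_const.update (Fin.rev j) continuous_id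
    exact (hGc j).comp hc.continuousOn fun s hs => hupd x hx (Fin.rev j) s hs
  -- derivatives along open fibres
  have hGder : ∀ j, ∀ x ∈ S, x (Fin.rev j) ∈ Set.Ioo (0:ℝ) 1 →
      HasDerivAt (fun s : ℝ => G j (Function.update x (Fin.rev j) s)) (D j x) (x (Fin.rev j)) := by
    refine Fin.forall_fin_two.2 ⟨fun x hx hx1 => ?_, fun x hx _ => ?_⟩
    · rw [rungAngSwap_rev_zero] at hx1 ⊢
      have hfun : (fun s : ℝ => G 0 (Function.update x 1 s)) =
          fun s => γ * (A s * B s) / (A s ^ 2 + B s ^ 2 * x 0 ^ 2) := by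
        funext s
        simp only [hG, hG0, Matrix.cons_val_zero, Function.update_self, Function.update_of_ne h01]
      have hDx : D 0 x = γ * ((A (x 1) * B' (x 1) - A' (x 1) * B (x 1)) *
          (A (x 1) ^ 2 - B (x 1) ^ 2 * x 0 ^ 2)) / (A (x 1) ^ 2 + B (x 1) ^ 2 * x 0 ^ 2) ^ 2 := by
        simp only [hD, hD0, Matrix.cons_val_zero]
      rw [hfun, hDx]
      exact rungAng_hasDerivAt_dir0 (hderA _ hx1) (hderB _ hx1) (hEne x hx)
    · rw [rungAngSwap_rev_one]
      have hfun : (fun s : ℝ => G 1 (Function.update x 0 s)) =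
          fun s => γ * s * (A (x 1) * B' (x 1) - A' (x 1) * B (x 1)) *
            (1 / (A (x 1) ^ 2 + B (x 1) ^ 2) - 1 / (A (x 1) ^ 2 + B (x 1) ^ 2 * s ^ 2)) := by
        funext s
        simp only [hG, hG1, Matrix.cons_val_one, Matrix.cons_val_fin_one, Function.update_self,
          Function.update_of_ne h10]
      have hDx : D 1 x = γ * (A (x 1) * B' (x 1) - A' (x 1) * B (x 1)) *
          (1 / (A (x 1) ^ 2 + B (x 1) ^ 2) -
            (A (x 1) ^ 2 - B (x 1) ^ 2 * x 0 ^ 2) / (A (x 1) ^ 2 + B (x 1) ^ 2 * x 0 ^ 2) ^ 2) := by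
        simp only [hD, hD1, Matrix.cons_val_one, Matrix.cons_val_fin_one]
      rw [hfun, hDx]
      exact rungAng_hasDerivAt_dir1 (hEne x hx)
  -- the two closed-square representations, with integrands `D j`
  let q : Fin 2 → IntegralRep 2 := fun j =>
    { domain := S
      integrand := D j
      isSemialgebraic_domain := hSsa
      isSemialgebraicFunOn_integrand := hDsa j
      integrableOn := (hDc j).integrableOn_compact hSc }
  refine ⟨G, D, q, fun j => ⟨hGsa j, hDsa j, hGbd j, hGfib j, hGder j⟩,
    fun j => ⟨rfl, fun x _ => ?_⟩, fun x _ => ?_⟩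
  · -- the integrand clause: boundary terms vanish
    show D j x = D j x - (G j (Function.update x (Fin.rev j) 1) - G j (Function.update x (Fin.rev j) 0))
    rw [hG_one, hG_zero, sub_zero, sub_zero]
  · -- the identity `γ K/E₁ = D₀ + D₁`
    show γ * ((A (x 1) * B' (x 1) - A' (x 1) * B (x 1)) / (A (x 1) ^ 2 + B (x 1) ^ 2)) = ∑ j, D j x
    rw [Fin.sum_univ_two]
    simp only [hD, hD0, hD1, Matrix.cons_val_zero, Matrix.cons_val_one, Matrix.cons_val_fin_one]
    ring

end Summit.KontsevichZagierPeriods.KontsevichZagierPeriods.Cruxes.StokesGeneration.FibrewiseStokes
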